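import Mathlib
import HarnessLib.Audit
import Summits.PneNP.PneNP.Theorems.PstarChordBridgeBasis

/-!
# Chord systems restricted to a fibre of base points: (★★) on a gate chamber (ROUND-24, memo §9 O2; prover-1 g15 `O2-SCOPING.md` §4 T-O2-1)

FRONTIER range-avoidance ladder, rung F-N3, ROUND 24 (cell `pnp-ideate`, planner memo `r24/CORE-BOUND-NOTES.md` §9 O2 / §10 "non-constant reads";
scoping notes `HOME/pnp-ideate-prover-1/g15/O2-SCOPING.md` §4, §7 T-O2-1 and `HOME/pnp-ideate-prover-2/g18/O1-SCOPING.md` §6; restricted-model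
proof complexity — nothing here bears on `P` versus `NP`).

The closed R-chain (`PstarChordBridgeFive`) makes every read vector `ρ_e(a)` constant in the base point (privates unread,
`PstarChordBridgeForcing.const_of_unread`).  With GATED reads (a pendant `(p_e, w)` on a chord private) the read coefficients are affine in `a`
and constant only on the CHAMBERS / FIBRES `Φ = {a : a_w = c_w, w ∈ Γ}` of the gate partners.  The model layer (`PstarChordSystem.ChordSystem`)
has an abstract base type, so a chord system RESTRICTS to any set `Φ` of base points (`restrict`; base type the subtype `Φ`), and every model
theorem applies to the restriction.  This file records the transport and the two consequences the O2 programme needs: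

* `restrict` and its bookkeeping (`val`, `Adm`, `Read` agree pointwise; `Infeasible` restricts; `ChordMinimal` of the restriction = a minimality
  WITNESS INSIDE `Φ`; single-read / constant reads ON `Φ`; `mapSys` commutes with restriction);
* `star_star_on` — **(★★) on a fibre**: single-read on `Φ`, reads constant on `Φ`, infeasible, chord-minimal in `e` with a witness in `Φ` ⟹
  `u_e = 1` on `Z ∩ Φ` (`PstarChordSystem.star_star` for the restricted system);
* `star_star_dir_on` — the same after the basis change `toX m` for a direction `m ≠ 0` carrying the reads ON `Φ` (`PstarChordSystemMap`);
* `witness_of_solution_erase`, `forced_on_fibre` — the instance form for bridge data `B` (`PstarChordBridge.sys`): if the reads of all chords lie on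
  the line `{0, m}` and are constant on `Φ`, the model is infeasible, and `(M0)` for the chord `e` has a solution `z` whose base point `bit ∘ z`
  lies in `Φ`, then `Q_{D e}(x) = γ_e + 1` for every `x ∈ Φ` with `q_m(x) = 0` — the hypothesis `hZ` of `PstarNorUnitExc.exc_unit_of_dir` /
  `PstarNorUnitExcCore.exc_unit_core` RELATIVE TO `Φ`, to be fed to `PstarQuadRestrict.forcing_cases_restrict` on the fibre.

What this does NOT address (O2-SCOPING §4): minimality witnesses of different chords may lie in different chambers ("chamber coherence").
-/

set_option linter.dupNamespace false -- `Summit.PneNP.PneNP.…`: summit = sub-problem name (D-0017 single-conjunct layout)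

open Finset Literature.Computability.Complexity
open Summit.PneNP.PneNP.Theorems.PstarFibrePolys (bit)
open Summit.PneNP.PneNP.Theorems.PstarTyped (Typed)
open Summit.PneNP.PneNP.Theorems.PstarProductRank (qform)
open Summit.PneNP.PneNP.Theorems.PstarReadSumset (V2)
open Summit.PneNP.PneNP.Theorems.PstarChordSystem (ChordSystem)
open Summit.PneNP.PneNP.Theorems.PstarChordSystemMap (mapSys toX mapSys_u mapSys_val mapSys_adm toX_zero toX_self_snd toX_injective
  infeasible_mapSys)
open Summit.PneNP.PneNP.Theorems.PstarChordBridge (BridgeData sys Solution val_of_solution eval_iff_adm)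
open Summit.PneNP.PneNP.Theorems.PstarChordBridgeForcing (gam sys_u_eq)
open Summit.PneNP.PneNP.Theorems.PstarChordBridgeBasis (qDir q_dir)

namespace Summit.PneNP.PneNP.Theorems.PstarChordSystemFibre

/-! ## Restriction of a chord system to a set of base points -/

section Model

variable {ι A : Type*}

/-- **The chord system restricted to the base points of `Φ`** (same products, reads, state-free part and target). -/
def restrict (S : ChordSystem ι A) (Φ : Set A) : ChordSystem ι Φ where
  u e a := S.u e a.1
  ρ e a := S.ρ e a.1
  ρ' e a := S.ρ' e a.1
  F a := S.F a.1
  t := S.t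

/-- Unfolding. -/
@[simp] theorem restrict_u (S : ChordSystem ι A) (Φ : Set A) (e : ι) (a : Φ) : (restrict S Φ).u e a = S.u e a.1 := rfl
/-- Unfolding. -/
@[simp] theorem restrict_ρ (S : ChordSystem ι A) (Φ : Set A) (e : ι) (a : Φ) : (restrict S Φ).ρ e a = S.ρ e a.1 := rfl
/-- Unfolding. -/
@[simp] theorem restrict_ρ' (S : ChordSystem ι A) (Φ : Set A) (e : ι) (a : Φ) : (restrict S Φ).ρ' e a = S.ρ' e a.1 := rfl
/-- Unfolding. -/
@[simp] theorem restrict_F (S : ChordSystem ι A) (Φ : Set A) (a : Φ) : (restrict S Φ).F a = S.F a.1 := rfl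
/-- Unfolding. -/
@[simp] theorem restrict_t (S : ChordSystem ι A) (Φ : Set A) : (restrict S Φ).t = S.t := rfl

/-- Basis change commutes with restriction. -/
theorem mapSys_restrict (S : ChordSystem ι A) (Φ : Set A) (φ : V2 →+ V2) : mapSys (restrict S Φ) φ = restrict (mapSys S φ) Φ := rfl

/-- Contributions agree pointwise. -/
theorem contrib_restrict (S : ChordSystem ι A) (Φ : Set A) (a : Φ) (s : ι → ZMod 2 × ZMod 2) (e : ι) :
    (restrict S Φ).contrib a s e = S.contrib a.1 s e := rfl

/-- Constraint values agree pointwise. -/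
theorem val_restrict (S : ChordSystem ι A) (Φ : Set A) (E : Finset ι) (a : Φ) (s : ι → ZMod 2 × ZMod 2) :
    (restrict S Φ).val E a s = S.val E a.1 s := rfl

/-- Admissibility agrees pointwise. -/
theorem adm_restrict_iff (S : ChordSystem ι A) (Φ : Set A) (E : Finset ι) (a : Φ) (s : ι → ZMod 2 × ZMod 2) :
    (restrict S Φ).Adm E a s ↔ S.Adm E a.1 s := Iff.rfl

/-- Being read agrees pointwise. -/
theorem read_restrict_iff (S : ChordSystem ι A) (Φ : Set A) (e : ι) (a : Φ) : (restrict S Φ).Read e a ↔ S.Read e a.1 := Iff.rfl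

/-- **Infeasibility restricts.** -/
theorem infeasible_restrict (S : ChordSystem ι A) (Φ : Set A) {E : Finset ι} (h : S.Infeasible E) : (restrict S Φ).Infeasible E :=
  fun a s hadm => h a.1 s hadm

/-- Single-read ON `Φ` gives a single-read restriction. -/
theorem singleRead_restrict (S : ChordSystem ι A) (Φ : Set A) (h : ∀ e, ∀ a ∈ Φ, (S.ρ e a).2 = 0 ∧ (S.ρ' e a).2 = 0) :
    (restrict S Φ).SingleRead := fun e a => h e a.1 a.2

/-- Reads constant ON `Φ` give constant reads of the restriction. -/
theorem const_restrict (S : ChordSystem ι A) (Φ : Set A) (h : ∀ e, ∀ a ∈ Φ, ∀ a' ∈ Φ, S.ρ e a = S.ρ e a' ∧ S.ρ' e a = S.ρ' e a') :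
    ∀ e (a a' : Φ), (restrict S Φ).ρ e a = (restrict S Φ).ρ e a' ∧ (restrict S Φ).ρ' e a = (restrict S Φ).ρ' e a' :=
  fun e a a' => h e a.1 a.2 a'.1 a'.2

variable [DecidableEq ι]

/-- **Chord-minimality of the restriction is a minimality witness inside `Φ`.** -/
theorem chordMinimal_restrict_iff (S : ChordSystem ι A) (Φ : Set A) (E : Finset ι) (e : ι) :
    (restrict S Φ).ChordMinimal E e ↔ ∃ a ∈ Φ, ∃ s, S.Adm (E.erase e) a s ∧ S.val E a s = S.t :=
  ⟨fun ⟨a, s, h1, h2⟩ => ⟨a.1, a.2, s, h1, h2⟩, fun ⟨a, ha, s, h1, h2⟩ => ⟨⟨a, ha⟩, s, h1, h2⟩⟩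

/-! ## (★★) on a fibre -/

/-- **(★★) on a fibre.**  Single-read on `Φ`, reads constant on `Φ`, infeasible, chord-minimal in `e ∈ E` with a witness base point in `Φ` ⟹ `e` is
forced ON at every point of `Z = {F₂ = t₂}` inside `Φ`. -/
theorem star_star_on (S : ChordSystem ι A) (Φ : Set A) (hS : ∀ e, ∀ a ∈ Φ, (S.ρ e a).2 = 0 ∧ (S.ρ' e a).2 = 0)
    (hconst : ∀ e, ∀ a ∈ Φ, ∀ a' ∈ Φ, S.ρ e a = S.ρ e a' ∧ S.ρ' e a = S.ρ' e a')
    {E : Finset ι} (hI : S.Infeasible E) {e : ι} (he : e ∈ E) (hM : ∃ a ∈ Φ, ∃ s, S.Adm (E.erase e) a s ∧ S.val E a s = S.t) :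
    ∀ a ∈ Φ, (S.F a).2 = S.t.2 → S.u e a = 1 := fun a ha hZ =>
  (restrict S Φ).star_star (singleRead_restrict S Φ hS) (const_restrict S Φ hconst) (infeasible_restrict S Φ hI) he
    ((chordMinimal_restrict_iff S Φ E e).2 hM) ⟨a, ha⟩ hZ

/-- **(★★) on a fibre, in a direction.**  If ON `Φ` every read vector lies on the line `{0, m}` (`m ≠ 0`) and the reads are constant, the system is
infeasible and chord-minimal in `e` with a witness in `Φ`, then after the basis change `toX m` the chord `e` is forced ON at every point of `Φ` where
the new second constraint vanishes. -/
theorem star_star_dir_on (S : ChordSystem ι A) (Φ : Set A) {E : Finset ι} (hI : S.Infeasible E) {m : V2} (hm : m ≠ 0)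
    (hU1 : ∀ e, ∀ a ∈ Φ, (S.ρ e a = 0 ∨ S.ρ e a = m) ∧ (S.ρ' e a = 0 ∨ S.ρ' e a = m))
    (hconst : ∀ e, ∀ a ∈ Φ, ∀ a' ∈ Φ, S.ρ e a = S.ρ e a' ∧ S.ρ' e a = S.ρ' e a')
    {e : ι} (he : e ∈ E) (hM : ∃ a ∈ Φ, ∃ s, S.Adm (E.erase e) a s ∧ S.val E a s = S.t) :
    ∀ a ∈ Φ, ((mapSys S (toX m)).F a).2 = (mapSys S (toX m)).t.2 → S.u e a = 1 := by
  intro a ha hZ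
  have hS' : ∀ e, ∀ a ∈ Φ, ((mapSys S (toX m)).ρ e a).2 = 0 ∧ ((mapSys S (toX m)).ρ' e a).2 = 0 := by
    intro e a ha
    refine ⟨?_, ?_⟩
    · show (toX m (S.ρ e a)).2 = 0
      rcases (hU1 e a ha).1 with h | h
      · rw [h, toX_zero]; rfl
      · rw [h]; exact toX_self_snd m
    · show (toX m (S.ρ' e a)).2 = 0
      rcases (hU1 e a ha).2 with h | h
      · rw [h, toX_zero]; rfl
      · rw [h]; exact toX_self_snd m
  have hconst' : ∀ e, ∀ a ∈ Φ, ∀ a' ∈ Φ, (mapSys S (toX m)).ρ e a = (mapSys S (toX m)).ρ e a' ∧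
      (mapSys S (toX m)).ρ' e a = (mapSys S (toX m)).ρ' e a' := by
    intro e a ha a' ha'
    obtain ⟨h1, h2⟩ := hconst e a ha a' ha'
    exact ⟨congrArg (toX m) h1, congrArg (toX m) h2⟩
  have hM' : ∃ a ∈ Φ, ∃ s, (mapSys S (toX m)).Adm (E.erase e) a s ∧ (mapSys S (toX m)).val E a s = (mapSys S (toX m)).t := by
    obtain ⟨a₀, ha₀, s, hadm, hval⟩ := hM
    exact ⟨a₀, ha₀, s, (mapSys_adm S (toX m) _ a₀ s).2 hadm, by rw [mapSys_val, hval]; rfl⟩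
  have h := star_star_on (mapSys S (toX m)) Φ hS' hconst' (infeasible_mapSys S (toX_injective hm) hI) he hM' a ha hZ
  rwa [mapSys_u] at h

end Model

/-! ## Instance form: bridge data -/

variable {n m : ℕ}

/-- **The (M0) witness, explicitly.**  A solution `z` of `(J₀ − e) ∧ Γ₁ ∧ Γ₂` gives a minimality witness of the model AT THE BASE POINT `bit ∘ z`
(this is `PstarChordBridge.chordMinimal_of_solution_erase` with the witness kept). -/
theorem witness_of_solution_erase (I : LocalMap 4 n m) (hI : I.IsPure xorAndPred) (hT : Typed I) {B : BridgeData n m} (hW : B.WF I)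
    {e : Fin m} (he : e ∈ B.N) {z : Fin n → Bool} (hz : Solution I B (B.J₀.erase e) z) :
    ∃ s, (sys I B).Adm (B.N.erase e) (fun v => bit (z v)) s ∧ (sys I B).val B.N (fun v => bit (z v)) s = (sys I B).t := by
  have hz' : ∀ j ∈ B.J₀ \ B.N, I.eval z j = B.y j := fun j hj =>
    hz.1 j (mem_erase.2 ⟨fun h => (mem_sdiff.1 hj).2 (h ▸ he), (mem_sdiff.1 hj).1⟩)
  refine ⟨fun e => (bit (z (I.vars e 2)), bit (z (I.vars e 3))), ?_, ?_⟩
  · intro e' he'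
    exact (eval_iff_adm I hI hW hz' (mem_of_mem_erase he')).1
      (hz.1 e' (mem_erase.2 ⟨ne_of_mem_erase he', hW.hN (mem_of_mem_erase he')⟩))
  · rw [val_of_solution I hI hT hW hz', hz.2.1, hz.2.2]
    rfl

/-- **(★★) on a fibre for bridge data.**  Reads of every chord on the line `{0, m}` and constant ON `Φ`, the model infeasible, and a solution of
`(J₀ − e) ∧ Γ₁ ∧ Γ₂` whose base point lies in `Φ`: then `Q_{D e}(x) = γ_e + 1` at every `x ∈ Φ` with `q_m(x) = 0`. -/
theorem forced_on_fibre (I : LocalMap 4 n m) (hI : I.IsPure xorAndPred) (hT : Typed I) {B : BridgeData n m} (hW : B.WF I)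
    (Φ : Set (Fin n → ZMod 2)) (hinf : (sys I B).Infeasible B.N) {mv : V2} (hmv : mv ≠ 0)
    (hU1 : ∀ e, ∀ a ∈ Φ, ((sys I B).ρ e a = 0 ∨ (sys I B).ρ e a = mv) ∧ ((sys I B).ρ' e a = 0 ∨ (sys I B).ρ' e a = mv))
    (hconst : ∀ e, ∀ a ∈ Φ, ∀ a' ∈ Φ, (sys I B).ρ e a = (sys I B).ρ e a' ∧ (sys I B).ρ' e a = (sys I B).ρ' e a')
    {e : Fin m} (he : e ∈ B.N) {z : Fin n → Bool} (hz : Solution I B (B.J₀.erase e) z) (hzΦ : (fun v => bit (z v)) ∈ Φ) :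
    ∀ x ∈ Φ, qDir I B mv x = 0 → qform (B.D e) (fun j => I.vars j 2) (fun j => I.vars j 3) x = gam B e + 1 := by
  intro x hx hq
  obtain ⟨s, hadm, hval⟩ := witness_of_solution_erase I hI hT hW he hz
  have hZ : ((mapSys (sys I B) (toX mv)).F x).2 = (mapSys (sys I B) (toX mv)).t.2 := by
    have h := q_dir I B mv x
    rw [hq] at h
    have e2 : ∀ a b : ZMod 2, a + b = 0 → a = b := by decide
    exact e2 _ _ h
  have h := star_star_dir_on (sys I B) Φ hinf hmv hU1 hconst he ⟨_, hzΦ, s, hadm, hval⟩ x hx hZ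
  rw [sys_u_eq] at h
  have e1 : ∀ g Q : ZMod 2, g + Q = 1 → Q = g + 1 := by decide
  exact e1 _ _ h

end Summit.PneNP.PneNP.Theorems.PstarChordSystemFibre
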